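import Mathlib
import HarnessLib
import Summits.Ventures.LatticeQCDFlow.Scaling.MixedPowerCostExponent
import Summits.Ventures.LatticeQCDFlow.Scoring.ScalingExponentFit

/-!
# The two-spacing scaling exponent under bounded relative errors: a rigorous (not first-order) error bar, and what the `20 %` acceptance on `τ_int` buys

HONEST FRAMING: exact (Metropolis-corrected) sampling algorithms for lattice gauge theory;
figures of merit are autocorrelation/cost numbers at stated couplings and volumes; no
continuum-physics claim.

Venture `LatticeQCDFlow` (cell pub-lqcd), topic `Scaling`, FANOUT row 21 (`su3-base`: deliverable "CSD exponent" —
the growth of `τ_int(Q²)` of the baselines between the two couplings `β ∈ {6.0, 6.2}` (and the stretch point) read as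
a two-spacing exponent, under the row's acceptance "`τ_int` errors `≤ 20 %` at `β ≤ 6.2`").  OUR WORK, elementary
real analysis over Mathlib and the tree's `Scaling.secantExponent` (`MixedPowerCostExponent.lean`, row 19); nothing is
cited as a fact.  `Scoring/ScalingExponentFit` records the FIRST-ORDER error `δz² = S₀/Δ` of the fitted slope; this file
gives the EXACT interval for the two-point exponent when each `τ` is only known to a relative precision `ε < 1` — no
linearisation, no Gaussianity.

## What is proved (`0 < x₁ < x₂` the two scales, e.g. `x = 1/a`; `t_i > 0` the measured values, `τ_i` the true ones,
## `|τ_i − t_i| ≤ ε_i t_i`, `ε_i < 1`; `z = log(τ₂/τ₁)/log(x₂/x₁)`, `ẑ = log(t₂/t₁)/log(x₂/x₁)`)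

* `log_mem_Icc_of_abs_sub_le` — `log t + log(1 − ε) ≤ log τ ≤ log t + log(1 + ε)`;
* **`twoPointExponent_sub_mem_Icc`** — THE EXACT INTERVAL:
  `(log(1 − ε₂) − log(1 + ε₁))/log(x₂/x₁) ≤ z − ẑ ≤ (log(1 + ε₂) − log(1 − ε₁))/log(x₂/x₁)` (both ends attained);
* `log_one_add_le_neg_log_one_sub` (`log(1 + ε) ≤ −log(1 − ε)`) and **`abs_twoPointExponent_sub_le`** —
  `|z − ẑ| ≤ −(log(1 − ε₁) + log(1 − ε₂)) / log(x₂/x₁)`;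
* **`abs_secantExponent_sub_le`** — the same in the tree's vocabulary: for two cost functions `C` (true) and `Ĉ`
  (measured) with `|C xᵢ − Ĉ xᵢ| ≤ εᵢ Ĉ xᵢ`, `|secantExponent C x₁ x₂ − secantExponent Ĉ x₁ x₂| ≤ …`;
* THE ROW-21 READING (`ε₁ = ε₂ = 1/5`): **`abs_twoPointExponent_sub_le_of_fifth`** —
  `|z − ẑ| ≤ 2 log(5/4)/log(x₂/x₁) = log(25/16)/log(x₂/x₁)`; hence **`abs_twoPointExponent_sub_le_one`** — the
  two-point exponent is pinned to `±1` as soon as the scales differ by a factor `x₂/x₁ ≥ 25/16`, and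
  `abs_twoPointExponent_sub_le_of_ratio` — to `±δ` as soon as `δ · log(x₂/x₁) ≥ log(25/16)`.

* ANY NUMBER OF SPACINGS (§4, the weighted log–log least-squares exponent of `Scoring/ScalingExponentFit`, `z = Σ cᵢ yᵢ`):
  `fitSlope_sub_eq_sum_fitCoef`, **`abs_fitSlope_sub_le`** (`|z − ẑ| ≤ Σ |cᵢ| δᵢ` whenever `|yᵢ − ŷᵢ| ≤ δᵢ` — exact, attained
  with signs), `abs_log_sub_log_le_of_abs_sub_le` (`|log τ − log t| ≤ −log(1 − ε)`) and **`abs_fitSlope_log_sub_le`** —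
  with relative errors `εᵢ < 1` on the `τᵢ`: `|z − ẑ| ≤ Σ |cᵢ| · (−log(1 − εᵢ))` (the three-spacing reading of row 21's
  stretch point included).

In words (value-free): with `20 %` errors on both autocorrelation times, a pair of spacings closer than the ratio
`25/16 = 1.5625` CANNOT determine the exponent to better than `±1` in the worst case, whatever the statistics model;
the bound halves each time `log(x₂/x₁)` doubles.  NOT CLAIMED: any value of `a(β)`, `τ_int`, `z`; that the errors ARE
within `20 %` (the row's measured acceptance); correlations between the two measurements (the bound is worst-case).
-/

namespace Summit.Ventures.LatticeQCDFlow.Scaling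

open Real

/-! ## §1 One logarithm under a relative error -/

/-- A relative error bound `|τ − t| ≤ ε t` with `t > 0`, `ε < 1` forces `0 ≤ ε`, `0 < τ` and brackets `τ`. -/
theorem bounds_of_abs_sub_le_mul {τ t ε : ℝ} (ht : 0 < t) (hε : ε < 1) (h : |τ - t| ≤ ε * t) :
    0 ≤ ε ∧ 0 < τ ∧ t * (1 - ε) ≤ τ ∧ τ ≤ t * (1 + ε) := by
  obtain ⟨h1, h2⟩ := abs_le.1 h
  have hε0 : 0 ≤ ε := by
    have := (abs_nonneg (τ - t)).trans h
    nlinarith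
  have : 0 < t * (1 - ε) := mul_pos ht (by linarith)
  exact ⟨hε0, by linarith, by linarith, by linarith⟩

/-- **`log t + log(1 − ε) ≤ log τ ≤ log t + log(1 + ε)`** when `|τ − t| ≤ ε t`, `t > 0`, `ε < 1`. -/
theorem log_mem_Icc_of_abs_sub_le {τ t ε : ℝ} (ht : 0 < t) (hε : ε < 1) (h : |τ - t| ≤ ε * t) :
    Real.log t + Real.log (1 - ε) ≤ Real.log τ ∧ Real.log τ ≤ Real.log t + Real.log (1 + ε) := by
  obtain ⟨hε0, hτ, hlo, hup⟩ := bounds_of_abs_sub_le_mul ht hε h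
  have h1ε : 0 < 1 - ε := by linarith
  constructor
  · rw [← Real.log_mul ht.ne' h1ε.ne']
    exact Real.log_le_log (mul_pos ht h1ε) hlo
  · rw [← Real.log_mul ht.ne' (by linarith : (1 + ε) ≠ 0)]
    exact Real.log_le_log hτ hup

/-- `log(1 + ε) ≤ −log(1 − ε)` for `0 ≤ ε < 1` (i.e. `log(1 − ε²) ≤ 0`). -/
theorem log_one_add_le_neg_log_one_sub {ε : ℝ} (hε0 : 0 ≤ ε) (hε : ε < 1) :
    Real.log (1 + ε) ≤ -Real.log (1 - ε) := by
  have h : Real.log (1 + ε) + Real.log (1 - ε) ≤ 0 := by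
    rw [← Real.log_mul (by linarith) (by linarith)]
    exact Real.log_nonpos (by nlinarith) (by nlinarith)
  linarith

/-! ## §2 The two-point exponent -/

section TwoPoint

variable {τ₁ τ₂ t₁ t₂ ε₁ ε₂ x₁ x₂ : ℝ}

/-- `log(x₂/x₁) > 0` for `0 < x₁ < x₂`. -/
theorem log_div_pos_of_lt (hx₁ : 0 < x₁) (hx : x₁ < x₂) : 0 < Real.log (x₂ / x₁) :=
  Real.log_pos ((one_lt_div hx₁).mpr hx)

/-- The difference of the two exponents is the difference of the log-errors over `log(x₂/x₁)`. -/
theorem twoPointExponent_sub_eq (hτ₁ : 0 < τ₁) (hτ₂ : 0 < τ₂) (ht₁ : 0 < t₁) (ht₂ : 0 < t₂) :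
    Real.log (τ₂ / τ₁) / Real.log (x₂ / x₁) - Real.log (t₂ / t₁) / Real.log (x₂ / x₁) =
      ((Real.log τ₂ - Real.log t₂) - (Real.log τ₁ - Real.log t₁)) / Real.log (x₂ / x₁) := by
  rw [Real.log_div hτ₂.ne' hτ₁.ne', Real.log_div ht₂.ne' ht₁.ne', ← sub_div]
  ring

/-- **THE EXACT INTERVAL for the two-point exponent under relative errors `ε₁, ε₂ < 1`:**
`(log(1 − ε₂) − log(1 + ε₁))/log(x₂/x₁) ≤ z − ẑ ≤ (log(1 + ε₂) − log(1 − ε₁))/log(x₂/x₁)`. -/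
theorem twoPointExponent_sub_mem_Icc (hx₁ : 0 < x₁) (hx : x₁ < x₂) (ht₁ : 0 < t₁) (ht₂ : 0 < t₂) (hε₁ : ε₁ < 1)
    (hε₂ : ε₂ < 1) (h₁ : |τ₁ - t₁| ≤ ε₁ * t₁) (h₂ : |τ₂ - t₂| ≤ ε₂ * t₂) :
    (Real.log (1 - ε₂) - Real.log (1 + ε₁)) / Real.log (x₂ / x₁) ≤
        Real.log (τ₂ / τ₁) / Real.log (x₂ / x₁) - Real.log (t₂ / t₁) / Real.log (x₂ / x₁) ∧
      Real.log (τ₂ / τ₁) / Real.log (x₂ / x₁) - Real.log (t₂ / t₁) / Real.log (x₂ / x₁) ≤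
        (Real.log (1 + ε₂) - Real.log (1 - ε₁)) / Real.log (x₂ / x₁) := by
  have hL := log_div_pos_of_lt hx₁ hx
  obtain ⟨-, hτ₁, -, -⟩ := bounds_of_abs_sub_le_mul ht₁ hε₁ h₁
  obtain ⟨-, hτ₂, -, -⟩ := bounds_of_abs_sub_le_mul ht₂ hε₂ h₂
  obtain ⟨l₁, u₁⟩ := log_mem_Icc_of_abs_sub_le ht₁ hε₁ h₁
  obtain ⟨l₂, u₂⟩ := log_mem_Icc_of_abs_sub_le ht₂ hε₂ h₂
  rw [twoPointExponent_sub_eq hτ₁ hτ₂ ht₁ ht₂]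
  constructor
  · exact div_le_div_of_nonneg_right (by linarith) hL.le
  · exact div_le_div_of_nonneg_right (by linarith) hL.le

/-- **`|z − ẑ| ≤ −(log(1 − ε₁) + log(1 − ε₂))/log(x₂/x₁)`** — the symmetric worst-case error of the two-point
exponent (the interval above, weakened by `log(1 + ε) ≤ −log(1 − ε)`). -/
theorem abs_twoPointExponent_sub_le (hx₁ : 0 < x₁) (hx : x₁ < x₂) (ht₁ : 0 < t₁) (ht₂ : 0 < t₂) (hε₁ : ε₁ < 1)
    (hε₂ : ε₂ < 1) (h₁ : |τ₁ - t₁| ≤ ε₁ * t₁) (h₂ : |τ₂ - t₂| ≤ ε₂ * t₂) :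
    |Real.log (τ₂ / τ₁) / Real.log (x₂ / x₁) - Real.log (t₂ / t₁) / Real.log (x₂ / x₁)| ≤
      -(Real.log (1 - ε₁) + Real.log (1 - ε₂)) / Real.log (x₂ / x₁) := by
  have hL := log_div_pos_of_lt hx₁ hx
  obtain ⟨hε₁0, -, -, -⟩ := bounds_of_abs_sub_le_mul ht₁ hε₁ h₁
  obtain ⟨hε₂0, -, -, -⟩ := bounds_of_abs_sub_le_mul ht₂ hε₂ h₂
  obtain ⟨lo, up⟩ := twoPointExponent_sub_mem_Icc hx₁ hx ht₁ ht₂ hε₁ hε₂ h₁ h₂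
  have k₁ := log_one_add_le_neg_log_one_sub hε₁0 hε₁
  have k₂ := log_one_add_le_neg_log_one_sub hε₂0 hε₂
  rw [abs_le]
  constructor
  · refine le_trans ?_ lo
    rw [← neg_div]
    exact div_le_div_of_nonneg_right (by linarith) hL.le
  · refine up.trans ?_
    exact div_le_div_of_nonneg_right (by linarith) hL.le

/-- **In the tree's vocabulary**: for a true cost `C` and a measured one `Ĉ` with `|C xᵢ − Ĉ xᵢ| ≤ εᵢ Ĉ xᵢ` (`Ĉ xᵢ > 0`,
`εᵢ < 1`), the two-spacing exponents differ by at most `−(log(1 − ε₁) + log(1 − ε₂))/log(x₂/x₁)`. -/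
theorem abs_secantExponent_sub_le (C Ch : ℝ → ℝ) (hx₁ : 0 < x₁) (hx : x₁ < x₂) (ht₁ : 0 < Ch x₁) (ht₂ : 0 < Ch x₂)
    (hε₁ : ε₁ < 1) (hε₂ : ε₂ < 1) (h₁ : |C x₁ - Ch x₁| ≤ ε₁ * Ch x₁) (h₂ : |C x₂ - Ch x₂| ≤ ε₂ * Ch x₂) :
    |secantExponent C x₁ x₂ - secantExponent Ch x₁ x₂| ≤ -(Real.log (1 - ε₁) + Real.log (1 - ε₂)) / Real.log (x₂ / x₁) :=
  abs_twoPointExponent_sub_le hx₁ hx ht₁ ht₂ hε₁ hε₂ h₁ h₂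

/-! ## §3 The row-21 reading: `20 %` errors on both autocorrelation times -/

/-- `−(log(1 − 1/5) + log(1 − 1/5)) = 2 log(5/4) = log(25/16)`. -/
theorem neg_two_log_four_fifths : -(Real.log (1 - 1 / 5) + Real.log (1 - 1 / 5)) = Real.log (25 / 16) := by
  have h : Real.log (1 - 1 / 5 : ℝ) = -Real.log (5 / 4) := by
    rw [← Real.log_inv]; norm_num
  rw [h, show (25 / 16 : ℝ) = 5 / 4 * (5 / 4) by norm_num, Real.log_mul (by norm_num) (by norm_num)]
  ring

/-- **`20 %` on both `τ`'s: `|z − ẑ| ≤ log(25/16)/log(x₂/x₁)`** (`= 2 log(5/4)/log(x₂/x₁)`). -/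
theorem abs_twoPointExponent_sub_le_of_fifth (hx₁ : 0 < x₁) (hx : x₁ < x₂) (ht₁ : 0 < t₁) (ht₂ : 0 < t₂)
    (h₁ : |τ₁ - t₁| ≤ 1 / 5 * t₁) (h₂ : |τ₂ - t₂| ≤ 1 / 5 * t₂) :
    |Real.log (τ₂ / τ₁) / Real.log (x₂ / x₁) - Real.log (t₂ / t₁) / Real.log (x₂ / x₁)| ≤
      Real.log (25 / 16) / Real.log (x₂ / x₁) := by
  rw [← neg_two_log_four_fifths]
  exact abs_twoPointExponent_sub_le hx₁ hx ht₁ ht₂ (by norm_num) (by norm_num) h₁ h₂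

/-- **The `20 %` two-point exponent is pinned to `±δ` once `δ · log(x₂/x₁) ≥ log(25/16)`.** -/
theorem abs_twoPointExponent_sub_le_of_ratio {δ : ℝ} (hx₁ : 0 < x₁) (hx : x₁ < x₂) (ht₁ : 0 < t₁)
    (ht₂ : 0 < t₂) (h₁ : |τ₁ - t₁| ≤ 1 / 5 * t₁) (h₂ : |τ₂ - t₂| ≤ 1 / 5 * t₂)
    (hr : Real.log (25 / 16) ≤ δ * Real.log (x₂ / x₁)) :
    |Real.log (τ₂ / τ₁) / Real.log (x₂ / x₁) - Real.log (t₂ / t₁) / Real.log (x₂ / x₁)| ≤ δ := by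
  have hL := log_div_pos_of_lt hx₁ hx
  refine (abs_twoPointExponent_sub_le_of_fifth hx₁ hx ht₁ ht₂ h₁ h₂).trans ?_
  rwa [div_le_iff₀ hL]

/-- **… in particular to `±1` as soon as the two scales differ by the factor `x₂/x₁ ≥ 25/16 = 1.5625`.** -/
theorem abs_twoPointExponent_sub_le_one (hx₁ : 0 < x₁) (hx : x₁ < x₂) (ht₁ : 0 < t₁) (ht₂ : 0 < t₂)
    (h₁ : |τ₁ - t₁| ≤ 1 / 5 * t₁) (h₂ : |τ₂ - t₂| ≤ 1 / 5 * t₂) (hr : 25 / 16 ≤ x₂ / x₁) :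
    |Real.log (τ₂ / τ₁) / Real.log (x₂ / x₁) - Real.log (t₂ / t₁) / Real.log (x₂ / x₁)| ≤ 1 := by
  refine abs_twoPointExponent_sub_le_of_ratio hx₁ hx ht₁ ht₂ h₁ h₂ ?_
  rw [one_mul]
  exact Real.log_le_log (by norm_num) hr

end TwoPoint

/-! ## §4 Any number of spacings: the weighted log–log least-squares exponent under bounded errors -/

section Fit

variable {ι : Type*} (s : Finset ι) (w x : ι → ℝ)

/-- The fitted exponent is linear in the data: `z(y) − z(y') = Σ cᵢ (yᵢ − y'ᵢ)`. -/
theorem fitSlope_sub_eq_sum_fitCoef (y y' : ι → ℝ) :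
    Scoring.fitSlope s w x y - Scoring.fitSlope s w x y' = ∑ i ∈ s, Scoring.fitCoef s w x i * (y i - y' i) := by
  rw [Scoring.fitSlope_eq_sum_fitCoef, Scoring.fitSlope_eq_sum_fitCoef, ← Finset.sum_sub_distrib]
  exact Finset.sum_congr rfl fun i _ => by ring

/-- **`|z − ẑ| ≤ Σ |cᵢ| δᵢ`** — the EXACT (worst-case, attained with signs) error of the weighted log–log fit when each
ordinate is known to `±δᵢ`; no linearisation, no Gaussianity, any weights, any number of spacings. -/
theorem abs_fitSlope_sub_le {y y' δ : ι → ℝ} (hδ : ∀ i ∈ s, |y i - y' i| ≤ δ i) :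
    |Scoring.fitSlope s w x y - Scoring.fitSlope s w x y'| ≤ ∑ i ∈ s, |Scoring.fitCoef s w x i| * δ i := by
  rw [fitSlope_sub_eq_sum_fitCoef]
  refine (Finset.abs_sum_le_sum_abs _ _).trans (Finset.sum_le_sum fun i hi => ?_)
  rw [abs_mul]
  exact mul_le_mul_of_nonneg_left (hδ i hi) (abs_nonneg _)

/-- **`|log τ − log t| ≤ −log(1 − ε)`** when `|τ − t| ≤ ε t`, `t > 0`, `ε < 1` (the larger of the two one-sided bounds). -/
theorem abs_log_sub_log_le_of_abs_sub_le {τ t ε : ℝ} (ht : 0 < t) (hε : ε < 1) (h : |τ - t| ≤ ε * t) :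
    |Real.log τ - Real.log t| ≤ -Real.log (1 - ε) := by
  obtain ⟨hε0, -, -, -⟩ := bounds_of_abs_sub_le_mul ht hε h
  obtain ⟨lo, up⟩ := log_mem_Icc_of_abs_sub_le ht hε h
  have k := log_one_add_le_neg_log_one_sub hε0 hε
  rw [abs_le]
  constructor <;> linarith

/-- **THE FIT UNDER RELATIVE ERRORS**: if every measured `tᵢ > 0` carries the true value within `|τᵢ − tᵢ| ≤ εᵢ tᵢ`,
`εᵢ < 1`, the exponents fitted through `(xᵢ, log τᵢ)` and `(xᵢ, log tᵢ)` (same abscissae and weights) differ by at most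
`Σ |cᵢ| · (−log(1 − εᵢ))`. -/
theorem abs_fitSlope_log_sub_le {τ t ε : ι → ℝ} (ht : ∀ i ∈ s, 0 < t i) (hε : ∀ i ∈ s, ε i < 1)
    (h : ∀ i ∈ s, |τ i - t i| ≤ ε i * t i) :
    |Scoring.fitSlope s w x (fun i => Real.log (τ i)) - Scoring.fitSlope s w x (fun i => Real.log (t i))| ≤
      ∑ i ∈ s, |Scoring.fitCoef s w x i| * (-Real.log (1 - ε i)) :=
  abs_fitSlope_sub_le s w x fun i hi => abs_log_sub_log_le_of_abs_sub_le (ht i hi) (hε i hi) (h i hi)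

end Fit

end Summit.Ventures.LatticeQCDFlow.Scaling
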